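import Mathlib.Analysis.SpecificLimits.Normed
import Mathlib.Analysis.SpecialFunctions.Log.Base
import Mathlib.Analysis.SpecialFunctions.Pow.Real
import Literature.Barriers.MatrixMultiplication.IrreversibilityBarrierProofs
import Literature.Barriers.MatrixMultiplication.UniversalMethodBarrierCwCount
import Literature.Barriers.MatrixMultiplication.UniversalMethodBarrierProducts
import Literature.Computability.AlgebraicComplexity.FlatteningRank
import Literature.Computability.AlgebraicComplexity.GroupAlgebraTensor
import Literature.Computability.AlgebraicComplexity.TensorMultiples
import HarnessLib

/-!
# CVZ 2021, Theorem 19 (small Coppersmith–Winograd tensors) — proved (`CVZ2021_thm19_holds`)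

Topic `Literature/Barriers/MatrixMultiplication`; DISCHARGE of the named fact `CVZ2021_thm19` of
`IrreversibilityBarrier.lean` (M. Christandl, P. Vrana, J. Zuiddam, *Barriers for fast matrix
multiplication from irreversibility*, Theory of Computing 17 (2021) = arXiv:1812.06952, **Thm. 19
in the arXiv numbering**, p. 9): for every field `K` and `q ≥ 1`,
`2 log₂(q+1) / (log₂ 3 − 2/3 + (2/3) log₂ q) ≤ 2 i(cw_q)`, where
`i(t) = ω(⟨2⟩,t) · ω(t,⟨2⟩)` (`irreversibility`, CVZ Def. 4) and `cw_q = cwTensor K q`.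
Sorry-free; a sibling file of `IrreversibilityBarrier.lean` / `IrreversibilityBarrierProofs.lean`
(whose `⟨q⟩^{⊗m} ≅ ⟨q^m⟩` lemmas `kroneckerPow_unitTensor_restrictsTo`, `unitTensor_pow_restrictsTo`
are reused) because the proof imports `UniversalMethodBarrierCwCount.lean`, which itself imports
`IrreversibilityBarrier.lean`. The proof does not go through `CVZ2021_relativeExponent_unit`
(`ω(⟨2⟩,t) = log₂ R̃(t)`, `ω(t,⟨2⟩) = 1/log₂ Q̃(t)`): it bounds the two relative exponents directly.

## Proof (CVZ p. 9, made effective in the tree's formalisation of `ω(t,s)` as an infimum)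

`ω(t,s) = inf_{n ≥ 1} n⁻¹ min {m | t^{⊗m} ≥ s^{⊗n}}`, so a lower bound `ω(t,s) ≥ c` follows from:
every defining set is nonempty, and every witness `t^{⊗m} ≥ s^{⊗n}` has `c n ≤ m`
(`le_relativeExponent_of_forall`).

* `ω(⟨2⟩, cw_q) ≥ log₂(q+1)` (print: "the rank of each flattening of `cw_q` equals `q+1`, therefore
  `R̃(cw_q) ≥ q+1`"): `⟨2⟩^{⊗m} ≥ cw_q^{⊗n}` gives `(q+1)^n = ζ⁽¹⁾(cw_q)^n = ζ⁽¹⁾(cw_q^{⊗n}) ≤ ζ⁽¹⁾(⟨2⟩^{⊗m}) ≤ 2^m`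
  (`flatteningRank_cwTensor`, multiplicativity and monotonicity of `ζ⁽¹⁾` from `FlatteningRank.lean`);
  witnesses exist since `⟨2⟩^{⊗R} ≥ ⟨2^R⟩ ≥ ⟨R⟩ ≥ cw_q^{⊗n}` for `R = R(cw_q^{⊗n})`.
* `ω(cw_q, ⟨2⟩) ≥ 1/c'`, `c' = log₂ 3 − 2/3 + (2/3) log₂ q` (print: the Strassen upper support
  functional `ρ^{(1/3,1/3,1/3)}(cw_q) ≤ c'` bounds `log₂ Q̃(cw_q)`). Here the same exponent is obtained
  from SLICE RANK by the partition/type-counting method already formalised for `CW_q` in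
  `UniversalMethodBarrierCwCount.lean` (Tao's lemma `S(⟨r⟩) = r`, monotonicity of `S`): on the
  support of `cw_q^{⊗m}` every position uses the classes `{0}, {1..q}` as a permutation of
  `(0,1,1)`, so weight-counting the three directions with `π = (1/3, 2/3, 0)` gives
  `min(type counts) ≤ B^m`, `B = (27q²/4)^{1/3} = 2^{c'}`, hence `S(cw_q^{⊗m}) ≤ 3(1 + (m+1)³ B^m)`
  (`sliceRank_cwsPow_le`). A witness `cw_q^{⊗m} ≥ ⟨2⟩^{⊗n}` gives, for every `k`,
  `cw_q^{⊗km} ≥ ⟨2^{nk}⟩`, so `2^{nk} ≤ 3(1 + (km+1)³ B^{km})`, and `k → ∞` yields `2^n ≤ B^m`, i.e.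
  `n ≤ m c'` (`two_pow_le_cwsBase_pow`). Witnesses exist since `cw_q^{⊗2} ≥ ⟨2⟩` by zeroing out
  (`tensorRestrictsTo_cwTensor_sq_unitTensor_two`).
* `i(cw_q) = ω(⟨2⟩,cw_q) ω(cw_q,⟨2⟩) ≥ log₂(q+1)/c'`.

## Content

* `le_relativeExponent_of_forall` — the lower-bound principle for `ω(t,s)`.
* `flatteningRank_cwTensor`, `pow_le_two_pow_of_unitPow_restrictsTo_cwPow`,
  `exists_unitPow_restrictsTo_cwPow`, `logb_le_relativeExponent_unit_cwTensor`.
* `cwsClass`, `classSize_cwsClass`, `cwTensor_classes_of_ne_zero`, `cwTensor_eq_one_of_ne_zero`,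
  `cwsPow_eq_one_of_ne_zero`, `cwsPow_wordType_sums`, `cwsBase`, `cwsTypeCount`,
  `min_cwsTypeCount_le`, `card_image_wordType_cws_le`, `card_cwsTypeCount_le`, `sliceRank_cwsPow_le`.
* `tensorRestrictsTo_cwTensor_sq_unitTensor_two`, `exists_cwPow_restrictsTo_unitPow`,
  `two_pow_le_cwsBase_pow`, `logb_cwsBase`, `le_mul_of_cwPow_restrictsTo_unitPow`,
  `inv_le_relativeExponent_cwTensor_unit`, `CVZ2021_thm19_holds`.

## References

* M. Christandl, P. Vrana, J. Zuiddam, Theory of Computing 17 (2021), art. 2 = arXiv:1812.06952,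
  Thm. 19 and its proof (p. 9, held: `paper:arxiv-1812.06952`). [ChristandlVranaZuiddam2021]
* J. Alman, Theory of Computing 17 (2021), art. 1, Thm. 3.4 / §4.1 (the type-counting slice-rank
  bound, as formalised in `UniversalMethodBarrierCwCount.lean`). [Alman2021]
-/

noncomputable section

open scoped BigOperators

namespace Literature.Barriers.MatrixMultiplication

open Literature.Computability.AlgebraicComplexity
open Filter Topology

universe u

/-! ## The lower-bound principle for relative exponents -/

section RelExp

variable {K : Type u} [CommSemiring K]
variable {ι κ μ ι' κ' μ' : Type*} [Fintype ι] [Fintype κ] [Fintype μ]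

/-- **Lower bounds on `ω(t,s)`**: if for every `n ≥ 1` some power of `t` restricts to `s^{⊗n}`
(so that no junk value `min ∅ = 0` occurs) and every witness `t^{⊗m} ≥ s^{⊗n}` has `c · n ≤ m`,
then `c ≤ ω(t,s) = inf_n n⁻¹ min {m | t^{⊗m} ≥ s^{⊗n}}`. [cite: ChristandlVranaZuiddam2021, Def. 2] -/
theorem le_relativeExponent_of_forall {t : ι → κ → μ → K} {s : ι' → κ' → μ' → K} {c : ℝ}
    (hne : ∀ n : ℕ, 1 ≤ n → ∃ m : ℕ, TensorRestrictsTo (kroneckerPow t m) (kroneckerPow s n))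
    (hc : ∀ n m : ℕ, 1 ≤ n → TensorRestrictsTo (kroneckerPow t m) (kroneckerPow s n) →
      c * n ≤ m) :
    c ≤ relativeExponent t s := by
  unfold relativeExponent
  refine le_ciInf fun n => ?_
  have hpos : (0 : ℝ) < (n : ℝ) + 1 := by positivity
  rw [le_div_iff₀ hpos]
  have hmem : TensorRestrictsTo (kroneckerPow t (restrictionCost t s (n + 1)))
      (kroneckerPow s (n + 1)) := Nat.sInf_mem (hne (n + 1) (Nat.succ_pos n))
  have h := hc (n + 1) _ (Nat.succ_pos n) hmem
  push_cast at h
  exact h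

end RelExp

/-! ## `ω(⟨2⟩, cw_q) ≥ log₂(q+1)` by flattening -/

section Flattening

variable {K : Type u} [Field K]

/-- **`ζ⁽¹⁾(cw_q) = q + 1`** (`q ≥ 1`): the `q+1` slices of `cw_q` are linearly independent
(evaluate a vanishing combination at `(y₁, z₁)` and at `(y₀, z_a)`) — "the rank of each flattening
of `cw_q` equals `q+1`". [cite: ChristandlVranaZuiddam2021, Thm. 19 (proof)] -/
theorem flatteningRank_cwTensor {q : ℕ} (hq : 1 ≤ q) : flatteningRank (cwTensor K q) = q + 1 := by
  have h10 : (1 : Fin (q + 1)) ≠ 0 := by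
    simp [Fin.ext_iff, Nat.mod_eq_of_lt (show 1 < q + 1 by omega)]
  have hli : LinearIndependent K (xSlices (cwTensor K q)) := by
    rw [Fintype.linearIndependent_iff]
    intro g hg a
    have hev : ∀ b c : Fin (q + 1), (∑ i, g i * cwTensor K q i b c) = 0 := by
      intro b c
      have := congrFun hg (b, c)
      simpa [Finset.sum_apply, Pi.smul_apply, xSlices_apply, smul_eq_mul] using this
    by_cases ha0 : a = 0
    · subst ha0
      have h1 := hev 1 1
      rw [Finset.sum_eq_single (0 : Fin (q + 1))] at h1
      · simpa [cwTensor_apply, h10] using h1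
      · intro i _ hi
        simp [cwTensor_apply, hi, h10]
      · simp
    · have h1 := hev 0 a
      rw [Finset.sum_eq_single a] at h1
      · simpa [cwTensor_apply, ha0] using h1
      · intro i _ hi
        simp [cwTensor_apply, hi, ha0, Ne.symm ha0]
      · simp
  unfold flatteningRank
  rw [finrank_span_eq_card hli, Fintype.card_fin]

/-- **The flattening bound**: `⟨2⟩^{⊗m} ≥ cw_q^{⊗n}` forces `(q+1)^n ≤ 2^m`
(`ζ⁽¹⁾` is multiplicative and restriction-monotone, `ζ⁽¹⁾(⟨2⟩) ≤ 2`).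
[cite: ChristandlVranaZuiddam2021, Thm. 19 (proof)] -/
theorem pow_le_two_pow_of_unitPow_restrictsTo_cwPow {q m n : ℕ} (hq : 1 ≤ q)
    (h : TensorRestrictsTo (kroneckerPow (unitTensor K 2) m) (kroneckerPow (cwTensor K q) n)) :
    (q + 1) ^ n ≤ 2 ^ m := by
  have h1 := flatteningRank_mono h
  rw [flatteningRank_kroneckerPow, flatteningRank_kroneckerPow, flatteningRank_cwTensor hq] at h1
  refine h1.trans (Nat.pow_le_pow_left ?_ m)
  have h2 : flatteningRank (unitTensor K 2) ≤ Fintype.card (Fin 2) := finrank_range_le_card _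
  simpa using h2

/-- The set defining `ω(⟨2⟩, cw_q)` at level `n` is nonempty: `⟨2⟩^{⊗R} ≥ ⟨2^R⟩ ≥ ⟨R⟩ ≥ cw_q^{⊗n}`
for `R = R(cw_q^{⊗n})`. [folklore] -/
theorem exists_unitPow_restrictsTo_cwPow (q n : ℕ) :
    ∃ m : ℕ, TensorRestrictsTo (kroneckerPow (unitTensor K 2) m) (kroneckerPow (cwTensor K q) n) := by
  set R := tensorRank (kroneckerPow (cwTensor K q) n)
  refine ⟨R, (kroneckerPow_unitTensor_restrictsTo (K := K) 2 R).trans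
    ((tensorRestrictsTo_unitTensor_castLE (K := K) (Nat.lt_two_pow_self).le).trans
      (tensorRestrictsTo_unitTensor_of_tensorRank_le _ le_rfl))⟩

/-- **`ω(⟨2⟩, cw_q) ≥ log₂(q+1)`** (`q ≥ 1`; print: `R̃(cw_q) ≥ q + 1` by flattening).
[cite: ChristandlVranaZuiddam2021, Thm. 19 (proof)] -/
theorem logb_le_relativeExponent_unit_cwTensor {q : ℕ} (hq : 1 ≤ q) :
    Real.logb 2 ((q : ℝ) + 1) ≤ relativeExponent (unitTensor K 2) (cwTensor K q) := by
  refine le_relativeExponent_of_forall (fun n _ => exists_unitPow_restrictsTo_cwPow q n)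
    fun n m _ h => ?_
  have h1 := pow_le_two_pow_of_unitPow_restrictsTo_cwPow hq h
  have h2 : ((q : ℝ) + 1) ^ n ≤ (2 : ℝ) ^ m := by exact_mod_cast h1
  have h3 := Real.logb_le_logb_of_le (b := 2) one_lt_two (by positivity) h2
  rw [Real.logb_pow, Real.logb_pow, Real.logb_self_eq_one one_lt_two, mul_one] at h3
  linarith

end Flattening

/-! ## The support of powers of `cw_q`: classes and type counts -/

section CwsSupport

/-- The two nonempty classes of coordinates of `cw_q`: `{0}` (class `0`) and `{1, …, q}` (class `1`);
class `2` is empty (so that the word-counting API of `UniversalMethodBarrierCwCount.lean`, written for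
three classes, applies verbatim). [cite: ChristandlVranaZuiddam2021, Thm. 19 (proof)] -/
def cwsClass (q : ℕ) : Fin (q + 1) → Fin 3 := fun a => if a = 0 then 0 else 1

/-- Class `0` is `{0}`. [folklore] -/
theorem cwsClass_eq_zero_iff (q : ℕ) (a : Fin (q + 1)) : cwsClass q a = 0 ↔ a = 0 := by
  unfold cwsClass
  by_cases h : a = 0 <;> simp [h]

/-- Class `1` is `{1, …, q}`. [folklore] -/
theorem cwsClass_eq_one_iff (q : ℕ) (a : Fin (q + 1)) : cwsClass q a = 1 ↔ a ≠ 0 := by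
  unfold cwsClass
  by_cases h : a = 0 <;> simp [h]

/-- Class `2` is empty. [folklore] -/
theorem cwsClass_ne_two (q : ℕ) (a : Fin (q + 1)) : cwsClass q a ≠ 2 := by
  unfold cwsClass
  by_cases h : a = 0 <;> simp [h]

/-- Class sizes `1, q, 0`. [folklore] -/
theorem classSize_cwsClass (q : ℕ) :
    classSize (cwsClass q) 0 = 1 ∧ classSize (cwsClass q) 1 = q ∧ classSize (cwsClass q) 2 = 0 := by
  refine ⟨?_, ?_, ?_⟩
  · rw [classSize, Finset.card_eq_one]
    refine ⟨0, ?_⟩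
    ext a
    simp [cwsClass_eq_zero_iff]
  · have hset : (Finset.univ.filter fun a : Fin (q + 1) => cwsClass q a = 1) = Finset.univ \ {0} := by
      ext a
      simp [cwsClass_eq_one_iff]
    rw [classSize, hset, Finset.card_sdiff_of_subset (Finset.subset_univ _), Finset.card_univ,
      Fintype.card_fin, Finset.card_singleton]
    omega
  · rw [classSize, Finset.card_eq_zero, Finset.filter_eq_empty_iff]
    intro a _
    exact cwsClass_ne_two q a

/-- Words never use class `2`. [folklore] -/
theorem wordType_cwsClass_two (q : ℕ) {m : ℕ} (A : Fin m → Fin (q + 1)) :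
    wordType (cwsClass q) A 2 = 0 :=
  wordType_eq_zero_of_classSize_eq_zero _ A (classSize_cwsClass q).2.2

variable {K : Type u} [Field K]

/-- **Support of `cw_q`**: the classes of a support triple are a permutation of `(0, 1, 1)` with
the `0` in the direction of the coordinate `0`. [cite: ChristandlVranaZuiddam2021, Thm. 19 (proof)] -/
theorem cwTensor_classes_of_ne_zero (q : ℕ) {a b c : Fin (q + 1)} (h : cwTensor K q a b c ≠ 0) :
    (cwsClass q a = 0 ∧ cwsClass q b = 1 ∧ cwsClass q c = 1) ∨
      (cwsClass q a = 1 ∧ cwsClass q b = 0 ∧ cwsClass q c = 1) ∨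
      (cwsClass q a = 1 ∧ cwsClass q b = 1 ∧ cwsClass q c = 0) := by
  rw [cwTensor_apply] at h
  split_ifs at h with hcond
  · simp only [cwsClass_eq_zero_iff, cwsClass_eq_one_iff]
    rcases hcond with ⟨h1, h2, h3⟩ | ⟨h1, h2, h3⟩ | ⟨h1, h2, h3⟩
    · exact Or.inl ⟨h1, h3, by rw [← h2]; exact h3⟩
    · exact Or.inr (Or.inl ⟨h3, h1, by rw [← h2]; exact h3⟩)
    · exact Or.inr (Or.inr ⟨h3, by rw [← h2]; exact h3, h1⟩)
  · exact absurd rfl h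

/-- `cw_q` is a `0/1` tensor. [folklore] -/
theorem cwTensor_eq_one_of_ne_zero (q : ℕ) {a b c : Fin (q + 1)} (h : cwTensor K q a b c ≠ 0) :
    cwTensor K q a b c = 1 := by
  rw [cwTensor_apply] at h ⊢
  split_ifs at h ⊢
  · rfl
  · exact absurd rfl h

/-- A power of `cw_q` is a `0/1` tensor. [folklore] -/
theorem cwsPow_eq_one_of_ne_zero (q m : ℕ) {A B C : Fin m → Fin (q + 1)}
    (h : kroneckerPow (cwTensor K q) m A B C ≠ 0) : kroneckerPow (cwTensor K q) m A B C = 1 := by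
  rw [kroneckerPow_apply, Finset.prod_ne_zero_iff] at h
  rw [kroneckerPow_apply]
  exact Finset.prod_eq_one fun i _ => cwTensor_eq_one_of_ne_zero q (h i (Finset.mem_univ _))

/-- **Total class counts on the support of `cw_q^{⊗m}`**: over the three directions class `0` is
used `m` times and class `1` is used `2m` times (one zero coordinate per position).
[cite: ChristandlVranaZuiddam2021, Thm. 19 (proof)] -/
theorem cwsPow_wordType_sums (q m : ℕ) {A B C : Fin m → Fin (q + 1)}
    (h : kroneckerPow (cwTensor K q) m A B C ≠ 0) :
    wordType (cwsClass q) A 0 + wordType (cwsClass q) B 0 + wordType (cwsClass q) C 0 = m ∧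
    wordType (cwsClass q) A 1 + wordType (cwsClass q) B 1 + wordType (cwsClass q) C 1 = 2 * m := by
  rw [kroneckerPow_apply, Finset.prod_ne_zero_iff] at h
  have hpos := fun i => cwTensor_classes_of_ne_zero q (h i (Finset.mem_univ _))
  have e0 : wordType (cwsClass q) A 0 + wordType (cwsClass q) B 0 + wordType (cwsClass q) C 0 =
      ∑ i : Fin m, ((if cwsClass q (A i) = 0 then 1 else 0) + (if cwsClass q (B i) = 0 then 1 else 0) +
        (if cwsClass q (C i) = 0 then 1 else 0)) := by
    simp only [wordType_eq_sum, Finset.sum_add_distrib]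
  have e1 : wordType (cwsClass q) A 1 + wordType (cwsClass q) B 1 + wordType (cwsClass q) C 1 =
      ∑ i : Fin m, ((if cwsClass q (A i) = 1 then 1 else 0) + (if cwsClass q (B i) = 1 then 1 else 0) +
        (if cwsClass q (C i) = 1 then 1 else 0)) := by
    simp only [wordType_eq_sum, Finset.sum_add_distrib]
  have h0 : ∀ i : Fin m, ((if cwsClass q (A i) = 0 then 1 else 0) + (if cwsClass q (B i) = 0 then 1 else 0) +
      (if cwsClass q (C i) = 0 then 1 else 0) : ℕ) = 1 := by
    intro i
    rcases hpos i with ⟨h1, h2, h3⟩ | ⟨h1, h2, h3⟩ | ⟨h1, h2, h3⟩ <;> simp [h1, h2, h3]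
  have h1 : ∀ i : Fin m, ((if cwsClass q (A i) = 1 then 1 else 0) + (if cwsClass q (B i) = 1 then 1 else 0) +
      (if cwsClass q (C i) = 1 then 1 else 0) : ℕ) = 2 := by
    intro i
    rcases hpos i with ⟨h1, h2, h3⟩ | ⟨h1, h2, h3⟩ | ⟨h1, h2, h3⟩ <;> simp [h1, h2, h3]
  refine ⟨?_, ?_⟩
  · rw [e0, Finset.sum_congr rfl fun i _ => h0 i, Finset.sum_const, Finset.card_univ, Fintype.card_fin,
      smul_eq_mul, mul_one]
  · rw [e1, Finset.sum_congr rfl fun i _ => h1 i, Finset.sum_const, Finset.card_univ, Fintype.card_fin,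
      smul_eq_mul, mul_comm]

/-- **The base** `B_q = (27 q² / 4)^{1/3} = 2^{log₂ 3 − 2/3 + (2/3) log₂ q} = 3 (q/2)^{2/3}` of the
bound `S(cw_q^{⊗m}) ≤ poly(m) B_q^m` (print: `2^{ρ^θ(cw_q)}`, `θ = (1/3,1/3,1/3)`).
[cite: ChristandlVranaZuiddam2021, Thm. 19 (proof)] -/
def cwsBase (q : ℕ) : ℝ := ((27 : ℝ) * (q : ℝ) ^ 2 / 4) ^ ((3 : ℝ)⁻¹)

/-- `B_q ≥ 0`. [folklore] -/
theorem cwsBase_nonneg (q : ℕ) : 0 ≤ cwsBase q := Real.rpow_nonneg (by positivity) _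

/-- `B_q³ = 27 q² / 4`. [folklore] -/
theorem cwsBase_pow_three (q : ℕ) : cwsBase q ^ 3 = 27 * (q : ℝ) ^ 2 / 4 := by
  unfold cwsBase
  have h := Real.rpow_inv_natCast_pow (x := (27 : ℝ) * (q : ℝ) ^ 2 / 4) (n := 3) (by positivity)
    (by norm_num)
  push_cast at h
  exact h

/-- `B_q ≥ 1` for `q ≥ 1`. [folklore] -/
theorem one_le_cwsBase {q : ℕ} (hq : 1 ≤ q) : 1 ≤ cwsBase q := by
  unfold cwsBase
  have hq1 : (1 : ℝ) ≤ q := by exact_mod_cast hq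
  refine Real.one_le_rpow ?_ (by norm_num)
  nlinarith

/-- The number of words with the same class type as `A`. [cite: ChristandlVranaZuiddam2021, Thm. 19 (proof)] -/
def cwsTypeCount (q : ℕ) {m : ℕ} (A : Fin m → Fin (q + 1)) : ℕ :=
  (Finset.univ.filter fun A' : Fin m → Fin (q + 1) =>
    wordType (cwsClass q) A' = wordType (cwsClass q) A).card

/-- **The per-triple bound**: for `(A,B,C)` in the support of `cw_q^{⊗m}` the least of the three
type counts is at most `B_q^m` — weight-count each direction with `π = (1/3, 2/3, 0)`
(`card_wordType_le`); the product of the three bounds is `3^m (3q/2)^{2m} = (B_q^m)³` (the averaged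
distribution of Alman's Prop. 3.8 / `min_typeCount_le_cwBase_pow`, here constant).
[cite: ChristandlVranaZuiddam2021, Thm. 19 (proof)] [cite: Alman2021, Prop. 3.8] -/
theorem min_cwsTypeCount_le (q m : ℕ) {A B C : Fin m → Fin (q + 1)}
    (h : kroneckerPow (cwTensor K q) m A B C ≠ 0) :
    (min (cwsTypeCount q A) (min (cwsTypeCount q B) (cwsTypeCount q C)) : ℝ) ≤ cwsBase q ^ m := by
  set ηA := wordType (cwsClass q) A with hηA
  set ηB := wordType (cwsClass q) B with hηB
  set ηC := wordType (cwsClass q) C with hηC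
  obtain ⟨hsum0, hsum1⟩ := cwsPow_wordType_sums q m h
  -- the distribution `π = (1/3, 2/3, 0)`
  set π : Fin 3 → ℝ := fun k => if k = 0 then 1 / 3 else if k = 1 then 2 / 3 else 0 with hπ
  have hπ0 : ∀ k, 0 ≤ π k := fun k => by
    rw [hπ]; dsimp only; split_ifs <;> norm_num
  have h20 : (2 : Fin 3) ≠ 0 := by decide
  have h21 : (2 : Fin 3) ≠ 1 := by decide
  have h10 : (1 : Fin 3) ≠ 0 := by decide
  have hπ1 : ∑ k, π k ≤ 1 := by
    rw [Fin.sum_univ_three, hπ]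
    simp only [h20, h21, h10, ↓reduceIte]
    norm_num
  have hposA : ∀ k, ηA k ≠ 0 → 0 < π k := by
    intro k hk
    fin_cases k
    · simp [hπ]
    · simp [hπ]
    · exact absurd (wordType_cwsClass_two q A) hk
  have hposB : ∀ k, ηB k ≠ 0 → 0 < π k := by
    intro k hk
    fin_cases k
    · simp [hπ]
    · simp [hπ]
    · exact absurd (wordType_cwsClass_two q B) hk
  have hposC : ∀ k, ηC k ≠ 0 → 0 < π k := by
    intro k hk
    fin_cases k
    · simp [hπ]
    · simp [hπ]
    · exact absurd (wordType_cwsClass_two q C) hk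
  have bA : (cwsTypeCount q A : ℝ) ≤ ∏ k, ((classSize (cwsClass q) k : ℝ) / π k) ^ ηA k :=
    card_wordType_le (cwsClass q) π hπ0 hπ1 ηA hposA (m := m)
  have bB : (cwsTypeCount q B : ℝ) ≤ ∏ k, ((classSize (cwsClass q) k : ℝ) / π k) ^ ηB k :=
    card_wordType_le (cwsClass q) π hπ0 hπ1 ηB hposB (m := m)
  have bC : (cwsTypeCount q C : ℝ) ≤ ∏ k, ((classSize (cwsClass q) k : ℝ) / π k) ^ ηC k :=
    card_wordType_le (cwsClass q) π hπ0 hπ1 ηC hposC (m := m)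
  set x : Fin 3 → ℝ := fun k => (classSize (cwsClass q) k : ℝ) / π k with hx
  have hx0 : ∀ k, 0 ≤ x k := fun k => div_nonneg (Nat.cast_nonneg _) (hπ0 k)
  -- the product of the three bounds is `3^m (3q/2)^{2m} = (27q²/4)^m = (B_q^m)^3`
  obtain ⟨c0, c1, -⟩ := classSize_cwsClass q
  have hA2 : ηA 2 = 0 := wordType_cwsClass_two q A
  have hB2 : ηB 2 = 0 := wordType_cwsClass_two q B
  have hC2 : ηC 2 = 0 := wordType_cwsClass_two q C
  have hx0v : x 0 = 3 := by
    rw [hx]; dsimp only; rw [c0, hπ]; norm_num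
  have hx1v : x 1 = 3 * q / 2 := by
    rw [hx]; dsimp only; rw [c1, hπ]
    simp only [Fin.isValue, one_ne_zero, ↓reduceIte]
    ring
  have hprod : (∏ k, x k ^ ηA k) * (∏ k, x k ^ ηB k) * (∏ k, x k ^ ηC k) = (cwsBase q ^ m) ^ 3 := by
    rw [← Finset.prod_mul_distrib, ← Finset.prod_mul_distrib]
    have : ∀ k, x k ^ ηA k * x k ^ ηB k * x k ^ ηC k = x k ^ (ηA k + ηB k + ηC k) := fun k => by
      rw [pow_add, pow_add]
    simp_rw [this]
    have e : (27 : ℝ) * (q : ℝ) ^ 2 / 4 = 3 * (3 * (q : ℝ) / 2) ^ 2 := by ring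
    rw [Fin.prod_univ_three, hsum0, hsum1, hA2, hB2, hC2, hx0v, hx1v, add_zero, add_zero, pow_zero,
      mul_one, ← pow_mul, mul_comm m 3, pow_mul, pow_mul, cwsBase_pow_three, e, mul_pow]
  have hPA : 0 ≤ ∏ k, x k ^ ηA k := Finset.prod_nonneg fun k _ => pow_nonneg (hx0 k) _
  have hPB : 0 ≤ ∏ k, x k ^ ηB k := Finset.prod_nonneg fun k _ => pow_nonneg (hx0 k) _
  set M := (min (cwsTypeCount q A) (min (cwsTypeCount q B) (cwsTypeCount q C)) : ℕ) with hM
  have hMA : (M : ℝ) ≤ cwsTypeCount q A := by exact_mod_cast min_le_left _ _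
  have hMB : (M : ℝ) ≤ cwsTypeCount q B := by
    exact_mod_cast (min_le_right _ _).trans (min_le_left _ _)
  have hMC : (M : ℝ) ≤ cwsTypeCount q C := by
    exact_mod_cast (min_le_right _ _).trans (min_le_right _ _)
  have hM0 : (0 : ℝ) ≤ M := Nat.cast_nonneg _
  have key : (M : ℝ) ^ 3 ≤ (cwsBase q ^ m) ^ 3 := by
    have eA := hMA.trans bA
    have eB := hMB.trans bB
    have eC := hMC.trans bC
    calc (M : ℝ) ^ 3 = (M : ℝ) * M * M := by ring
      _ ≤ (∏ k, x k ^ ηA k) * (∏ k, x k ^ ηB k) * (∏ k, x k ^ ηC k) :=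
          mul_le_mul (mul_le_mul eA eB hM0 hPA) eC hM0 (mul_nonneg hPA hPB)
      _ = (cwsBase q ^ m) ^ 3 := hprod
  have := le_of_pow_le_pow_left₀ (by norm_num : (3 : ℕ) ≠ 0) (pow_nonneg (cwsBase_nonneg q) m) key
  push_cast [hM] at this ⊢
  exact this

/-! ## The finite slice-rank bound for powers of `cw_q` -/

/-- The number of class types of words of length `m` is at most `(m+1)³`. [folklore] -/
theorem card_image_wordType_cws_le (q m : ℕ) :
    ((Finset.univ.image fun A : Fin m → Fin (q + 1) => wordType (cwsClass q) A).card : ℝ) ≤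
      ((m : ℝ) + 1) ^ 3 := by
  classical
  have hsub : (Finset.univ.image fun A : Fin m → Fin (q + 1) => wordType (cwsClass q) A) ⊆
      Finset.univ.image (fun f : Fin 3 → Fin (m + 1) => fun k => ((f k : Fin (m + 1)) : ℕ)) := by
    intro η hη
    obtain ⟨A, -, rfl⟩ := Finset.mem_image.1 hη
    refine Finset.mem_image.2 ⟨fun k => ⟨wordType (cwsClass q) A k, Nat.lt_succ_of_le ?_⟩,
      Finset.mem_univ _, rfl⟩
    calc wordType (cwsClass q) A k ≤ ∑ k, wordType (cwsClass q) A k :=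
          Finset.single_le_sum (fun k _ => Nat.zero_le _) (Finset.mem_univ k)
      _ = m := sum_wordType _ A
  have h1 := Finset.card_le_card hsub
  have h2 : (Finset.univ.image (fun f : Fin 3 → Fin (m + 1) => fun k => ((f k : Fin (m + 1)) : ℕ))).card ≤
      (m + 1) ^ 3 := by
    refine (Finset.card_image_le).trans ?_
    simp [Fintype.card_fin]
  have : ((Finset.univ.image fun A : Fin m → Fin (q + 1) => wordType (cwsClass q) A).card : ℝ) ≤
      ((m + 1) ^ 3 : ℕ) := by
    exact_mod_cast h1.trans h2
  push_cast at this
  exact this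

/-- The number of words whose type count is at most `M` is at most `(m+1)³ M`. [folklore] -/
theorem card_cwsTypeCount_le (q m : ℕ) {M : ℝ} (hM : 0 ≤ M) :
    ((Finset.univ.filter fun A : Fin m → Fin (q + 1) => (cwsTypeCount q A : ℝ) ≤ M).card : ℝ) ≤
      ((m : ℝ) + 1) ^ 3 * M := by
  classical
  set types := Finset.univ.image fun A : Fin m → Fin (q + 1) => wordType (cwsClass q) A with htypes
  have hfib := Finset.card_eq_sum_card_fiberwise
    (f := fun A : Fin m → Fin (q + 1) => wordType (cwsClass q) A)
    (s := Finset.univ.filter fun A : Fin m → Fin (q + 1) => (cwsTypeCount q A : ℝ) ≤ M) (t := types)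
    (fun A _ => Finset.mem_image_of_mem _ (Finset.mem_univ A))
  have hbound : ∀ η ∈ types,
      (((Finset.univ.filter fun A : Fin m → Fin (q + 1) => (cwsTypeCount q A : ℝ) ≤ M).filter
        fun A => wordType (cwsClass q) A = η).card : ℝ) ≤ M := by
    intro η _
    by_cases hη : ((Finset.univ.filter fun A' : Fin m → Fin (q + 1) =>
        wordType (cwsClass q) A' = η).card : ℝ) ≤ M
    · refine le_trans ?_ hη
      exact_mod_cast Finset.card_le_card (fun A hA => by
        simp only [Finset.mem_filter, Finset.mem_univ, true_and] at hA ⊢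
        exact hA.2)
    · have : ((Finset.univ.filter fun A : Fin m → Fin (q + 1) => (cwsTypeCount q A : ℝ) ≤ M).filter
          fun A => wordType (cwsClass q) A = η) = ∅ := by
        rw [Finset.filter_eq_empty_iff]
        intro A hA hAη
        have hA' := (Finset.mem_filter.1 hA).2
        rw [cwsTypeCount, hAη] at hA'
        exact hη hA'
      rw [this, Finset.card_empty, Nat.cast_zero]
      exact hM
  calc ((Finset.univ.filter fun A : Fin m → Fin (q + 1) => (cwsTypeCount q A : ℝ) ≤ M).card : ℝ)
      = ∑ η ∈ types, (((Finset.univ.filter fun A : Fin m → Fin (q + 1) =>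
          (cwsTypeCount q A : ℝ) ≤ M).filter fun A => wordType (cwsClass q) A = η).card : ℝ) := by
        rw [hfib]; push_cast; rfl
    _ ≤ ∑ _η ∈ types, M := Finset.sum_le_sum hbound
    _ = (types.card : ℝ) * M := by rw [Finset.sum_const, nsmul_eq_mul]
    _ ≤ ((m : ℝ) + 1) ^ 3 * M := mul_le_mul_of_nonneg_right (card_image_wordType_cws_le q m) hM

open Literature.Combinatorics.Additive in
/-- **Finite slice-rank bound for the small Coppersmith–Winograd tensors**:
`S(cw_q^{⊗m}) ≤ 3 (1 + (m+1)³ B_q^m)`, `B_q = (27q²/4)^{1/3} = 2^{log₂ 3 − 2/3 + (2/3) log₂ q}`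
(cover the support of `cw_q^{⊗m}` by the three families of words whose type count is `≤ B_q^m`,
`hasSliceRankLE_of_cover`; by `min_cwsTypeCount_le` every support triple has such a coordinate).
This replaces the printed upper support functional bound `ζ^{(1/3,1/3,1/3)}(cw_q) ≤ B_q` in the
role "`Q(cw_q^{⊗m})` grows at most like `B_q^m`"; the counting method is that of Alman's Thm. 3.4
(as formalised for `CW_q` in `sliceRank_cwPow_le`). [cite: ChristandlVranaZuiddam2021, Thm. 19 (proof)]
[cite: Alman2021, Thm. 3.4 (proof)] -/
theorem sliceRank_cwsPow_le (q m : ℕ) :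
    (sliceRank (kroneckerPow (cwTensor K q) m) : ℝ) ≤ 3 * (1 + ((m : ℝ) + 1) ^ 3 * cwsBase q ^ m) := by
  classical
  set T := kroneckerPow (cwTensor K q) m with hT
  set B := cwsBase q with hBdef
  have hBm : 0 ≤ B ^ m := pow_nonneg (cwsBase_nonneg q) m
  -- every support triple has a coordinate with small type count
  have hgood : ∀ A B' C : Fin m → Fin (q + 1), T A B' C ≠ 0 →
      (cwsTypeCount q A : ℝ) ≤ B ^ m ∨ (cwsTypeCount q B' : ℝ) ≤ B ^ m ∨
        (cwsTypeCount q C : ℝ) ≤ B ^ m := by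
    intro A B' C h
    have h2 := min_cwsTypeCount_le q m h
    by_contra hall
    push Not at hall
    obtain ⟨hA, hB', hC⟩ := hall
    have : B ^ m < (min (cwsTypeCount q A) (min (cwsTypeCount q B') (cwsTypeCount q C)) : ℝ) :=
      lt_min hA (lt_min hB' hC)
    linarith
  -- the covering families
  set S := Option {A : Fin m → Fin (q + 1) // (cwsTypeCount q A : ℝ) ≤ B ^ m} with hS
  set Ω := {ω : (Fin m → Fin (q + 1)) × (Fin m → Fin (q + 1)) × (Fin m → Fin (q + 1)) //
    T ω.1 ω.2.1 ω.2.2 ≠ 0} with hΩ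
  set πo : (Fin m → Fin (q + 1)) → S := fun A =>
    if h : (cwsTypeCount q A : ℝ) ≤ B ^ m then some ⟨A, h⟩ else none with hπo
  set φ : S → (Fin m → Fin (q + 1)) → K := fun s =>
    Option.elim s (fun _ => 0) (fun p x => if x = p.1 then 1 else 0) with hφ
  have hφπ : ∀ A, (cwsTypeCount q A : ℝ) ≤ B ^ m → φ (πo A) = fun x => if x = A then 1 else 0 := by
    intro A hA
    simp only [hφ, hπo, dif_pos hA, Option.elim_some]
  have hcover : HasSliceRankLE T (Fintype.card S + Fintype.card S + Fintype.card S) := by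
    refine hasSliceRankLE_of_cover (Ω := Ω) T (fun ω x => if x = ω.1.1 then 1 else 0)
      (fun ω y => if y = ω.1.2.1 then 1 else 0) (fun ω z => if z = ω.1.2.2 then 1 else 0) ?_
      (fun ω => if (cwsTypeCount q ω.1.1 : ℝ) ≤ B ^ m then 0
        else if (cwsTypeCount q ω.1.2.1 : ℝ) ≤ B ^ m then 1 else 2)
      (fun ω => πo ω.1.1) φ ?_ (fun ω => πo ω.1.2.1) φ ?_ (fun ω => πo ω.1.2.2) φ ?_
    · -- `T = Σ_ω e_A ⊗ e_B ⊗ e_C`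
      intro x y z
      by_cases hxyz : T x y z = 0
      · rw [hxyz]
        refine (Finset.sum_eq_zero fun ω _ => ?_).symm
        have hne : (ω : _).1 ≠ (x, y, z) := fun e => ω.2 (by rw [e]; exact hxyz)
        by_cases h1 : x = ω.1.1
        · by_cases h2 : y = ω.1.2.1
          · have h3 : z ≠ ω.1.2.2 := fun h3 => hne (by ext <;> simp [h1, h2, h3])
            simp [h3]
          · simp [h2]
        · simp [h1]
      · have hone : T x y z = 1 := cwsPow_eq_one_of_ne_zero q m hxyz
        rw [Finset.sum_eq_single ⟨(x, y, z), hxyz⟩]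
        · simp [hone]
        · intro ω _ hω
          have hne : (ω : _).1 ≠ (x, y, z) := fun e => hω (Subtype.ext e)
          by_cases h1 : x = ω.1.1
          · by_cases h2 : y = ω.1.2.1
            · have h3 : z ≠ ω.1.2.2 := fun h3 => hne (by ext <;> simp [h1, h2, h3])
              simp [h3]
            · simp [h2]
          · simp [h1]
        · simp
    · intro ω hω
      have hA : (cwsTypeCount q ω.1.1 : ℝ) ≤ B ^ m := by
        by_contra hA
        rw [if_neg hA] at hω
        split_ifs at hω <;> exact absurd hω (by decide)
      exact (hφπ _ hA).symm
    · intro ω hω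
      have hB' : (cwsTypeCount q ω.1.2.1 : ℝ) ≤ B ^ m := by
        by_cases hA : (cwsTypeCount q ω.1.1 : ℝ) ≤ B ^ m
        · rw [if_pos hA] at hω; exact absurd hω (by decide)
        · by_contra hB'
          rw [if_neg hA, if_neg hB'] at hω
          exact absurd hω (by decide)
      exact (hφπ _ hB').symm
    · intro ω hω
      have hC : (cwsTypeCount q ω.1.2.2 : ℝ) ≤ B ^ m := by
        by_cases hA : (cwsTypeCount q ω.1.1 : ℝ) ≤ B ^ m
        · rw [if_pos hA] at hω; exact absurd hω (by decide)
        · by_cases hB' : (cwsTypeCount q ω.1.2.1 : ℝ) ≤ B ^ m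
          · rw [if_neg hA, if_pos hB'] at hω; exact absurd hω (by decide)
          · rcases hgood _ _ _ ω.2 with h | h | h
            · exact absurd h hA
            · exact absurd h hB'
            · exact h
      exact (hφπ _ hC).symm
  -- count
  have hcard : (Fintype.card S : ℝ) ≤ 1 + ((m : ℝ) + 1) ^ 3 * B ^ m := by
    show (Fintype.card (Option {A : Fin m → Fin (q + 1) // (cwsTypeCount q A : ℝ) ≤ B ^ m}) : ℝ) ≤ _
    rw [Fintype.card_option, Fintype.card_subtype]
    push_cast
    linarith [card_cwsTypeCount_le q m hBm]
  have h1 := hcover.sliceRank_le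
  calc (sliceRank T : ℝ) ≤ ((Fintype.card S + Fintype.card S + Fintype.card S : ℕ) : ℝ) := by
        exact_mod_cast h1
    _ = 3 * (Fintype.card S : ℝ) := by push_cast; ring
    _ ≤ 3 * (1 + ((m : ℝ) + 1) ^ 3 * B ^ m) := by linarith

end CwsSupport

/-! ## `ω(cw_q, ⟨2⟩) ≥ 1 / (log₂ 3 − 2/3 + (2/3) log₂ q)` -/

section Subrank

variable {K : Type u} [Field K]

/-- **`cw_q^{⊗2} ≥ ⟨2⟩`** (`q ≥ 1`): zeroing out to the block `a ∈ {00, 11}`, `b ∈ {11, 01}`,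
`c ∈ {11, 10}` leaves exactly the diagonal `e_{(00,11,11)} + e_{(11,01,10)}` of `cw_q^{⊗2}`
(so the sets defining `ω(cw_q, ⟨2⟩)` are nonempty; for `q = 1`, `cw_1 = W` has `Q(W) = 1` but
`Q(W^{⊗2}) = 2`). [folklore] -/
theorem tensorRestrictsTo_cwTensor_sq_unitTensor_two {q : ℕ} (hq : 1 ≤ q) :
    TensorRestrictsTo (kroneckerPow (cwTensor K q) 2) (unitTensor K 2) := by
  have h10 : (1 : Fin (q + 1)) ≠ 0 := by
    simp [Fin.ext_iff, Nat.mod_eq_of_lt (show 1 < q + 1 by omega)]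
  set f : Fin 2 → Fin 2 → Fin (q + 1) := fun a => if a = 0 then ![0, 0] else ![1, 1] with hf
  set g : Fin 2 → Fin 2 → Fin (q + 1) := fun b => if b = 0 then ![1, 1] else ![0, 1] with hg
  set h : Fin 2 → Fin 2 → Fin (q + 1) := fun c => if c = 0 then ![1, 1] else ![1, 0] with hh
  have key : unitTensor K 2 = fun a b c => kroneckerPow (cwTensor K q) 2 (f a) (g b) (h c) := by
    funext a b c
    fin_cases a <;> fin_cases b <;> fin_cases c <;>
      simp [kroneckerPow_apply, Fin.prod_univ_two, cwTensor_apply, hf, hg, hh, h10, h10.symm]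
  rw [key]
  exact tensorRestrictsTo_precomp _ _ _ _

/-- The set defining `ω(cw_q, ⟨2⟩)` at level `n` is nonempty: `cw_q^{⊗2n} ≥ (cw_q^{⊗2})^{⊗n} ≥ ⟨2⟩^{⊗n}`.
[folklore] -/
theorem exists_cwPow_restrictsTo_unitPow {q : ℕ} (hq : 1 ≤ q) (n : ℕ) :
    ∃ m : ℕ, TensorRestrictsTo (kroneckerPow (cwTensor K q) m) (kroneckerPow (unitTensor K 2) n) :=
  ⟨n * 2, (tensorRestrictsTo_kroneckerPow_mul (cwTensor K q) n 2).trans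
    ((tensorRestrictsTo_cwTensor_sq_unitTensor_two hq).kroneckerPow n)⟩

/-- Powers of a witness: `cw_q^{⊗m} ≥ ⟨2⟩^{⊗n}` gives `cw_q^{⊗km} ≥ (cw_q^{⊗m})^{⊗k} ≥ (⟨2⟩^{⊗n})^{⊗k}
≥ ⟨2^n⟩^{⊗k} ≥ ⟨(2^n)^k⟩` for every `k`. [folklore] -/
theorem restrictsTo_unitTensor_pow_of_cwPow_restrictsTo_unitPow {q m n : ℕ}
    (h : TensorRestrictsTo (kroneckerPow (cwTensor K q) m) (kroneckerPow (unitTensor K 2) n)) (k : ℕ) :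
    TensorRestrictsTo (kroneckerPow (cwTensor K q) (k * m)) (unitTensor K ((2 ^ n) ^ k)) :=
  (tensorRestrictsTo_kroneckerPow_mul (cwTensor K q) k m).trans
    ((h.kroneckerPow k).trans
      (((kroneckerPow_unitTensor_restrictsTo (K := K) 2 n).kroneckerPow k).trans
        (kroneckerPow_unitTensor_restrictsTo (K := K) (2 ^ n) k)))

/-- **The multiplicative subrank bound**: a witness `cw_q^{⊗m} ≥ ⟨2⟩^{⊗n}` forces `2^n ≤ B_q^m`
(`B_q = (27q²/4)^{1/3}`): by the previous lemma, Tao's lemma and `sliceRank_cwsPow_le`,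
`2^{nk} ≤ S(cw_q^{⊗km}) ≤ 3(1 + (km+1)³ B_q^{km})` for every `k`, and an exponential cannot be
dominated by a polynomial (`tendsto_pow_const_div_const_pow_of_one_lt`). In print this is
`Q̃(cw_q) ≤ ζ^{(1/3,1/3,1/3)}(cw_q) = B_q`. [cite: ChristandlVranaZuiddam2021, Thm. 19 (proof)] -/
theorem two_pow_le_cwsBase_pow {q m n : ℕ} (hq : 1 ≤ q)
    (h : TensorRestrictsTo (kroneckerPow (cwTensor K q) m) (kroneckerPow (unitTensor K 2) n)) :
    (2 : ℝ) ^ n ≤ cwsBase q ^ m := by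
  set B := cwsBase q with hBdef
  have hB1 : 1 ≤ B := one_le_cwsBase hq
  -- the finite bounds, one for every power `k`
  have hk : ∀ k : ℕ, ((2 : ℝ) ^ n) ^ k ≤ 3 * (1 + (((k * m : ℕ) : ℝ) + 1) ^ 3 * B ^ (k * m)) := by
    intro k
    have h1 := le_sliceRank_of_restrictsTo_unitTensor
      (restrictsTo_unitTensor_pow_of_cwPow_restrictsTo_unitPow h k)
    have h2 : (((2 ^ n) ^ k : ℕ) : ℝ) ≤ sliceRank (kroneckerPow (cwTensor K q) (k * m)) := by
      exact_mod_cast h1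
    push_cast at h2
    exact h2.trans (sliceRank_cwsPow_le q (k * m))
  by_contra hlt
  push Not at hlt
  have hBm : 0 < B ^ m := by positivity
  set r : ℝ := 2 ^ n / B ^ m with hr
  have hr1 : 1 < r := (one_lt_div hBm).2 hlt
  set c : ℝ := 6 * ((m : ℝ) + 1) ^ 3 with hc
  have hc0 : 0 < c := by positivity
  -- `r^k ≤ c k³` for `k ≥ 1`
  have hbound : ∀ k : ℕ, 1 ≤ k → r ^ k ≤ c * (k : ℝ) ^ 3 := by
    intro k hk1
    have hk1' : (1 : ℝ) ≤ k := by exact_mod_cast hk1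
    have hBkm : 1 ≤ B ^ (k * m) := one_le_pow₀ hB1
    have hkm0 : (0 : ℝ) ≤ ((k * m : ℕ) : ℝ) := Nat.cast_nonneg _
    have hP1 : (1 : ℝ) ≤ (((k * m : ℕ) : ℝ) + 1) ^ 3 := one_le_pow₀ (by linarith)
    have hpoly : ((k * m : ℕ) : ℝ) + 1 ≤ (k : ℝ) * ((m : ℝ) + 1) := by
      push_cast
      nlinarith
    have hP3 : (((k * m : ℕ) : ℝ) + 1) ^ 3 ≤ ((k : ℝ) * ((m : ℝ) + 1)) ^ 3 :=
      pow_le_pow_left₀ (by positivity) hpoly 3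
    have hPB : (1 : ℝ) ≤ (((k * m : ℕ) : ℝ) + 1) ^ 3 * B ^ (k * m) := by nlinarith
    have hBmk : (B ^ m) ^ k = B ^ (k * m) := by rw [← pow_mul, mul_comm]
    have hBmk0 : (0 : ℝ) < (B ^ m) ^ k := pow_pos hBm k
    have hnum : ((2 : ℝ) ^ n) ^ k ≤ c * (k : ℝ) ^ 3 * (B ^ m) ^ k :=
      calc ((2 : ℝ) ^ n) ^ k ≤ 3 * (1 + (((k * m : ℕ) : ℝ) + 1) ^ 3 * B ^ (k * m)) := hk k
        _ ≤ 3 * ((((k * m : ℕ) : ℝ) + 1) ^ 3 * B ^ (k * m) + (((k * m : ℕ) : ℝ) + 1) ^ 3 * B ^ (k * m)) := by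
            linarith
        _ = 6 * (((k * m : ℕ) : ℝ) + 1) ^ 3 * B ^ (k * m) := by ring
        _ ≤ 6 * ((k : ℝ) * ((m : ℝ) + 1)) ^ 3 * B ^ (k * m) := by gcongr
        _ = c * (k : ℝ) ^ 3 * (B ^ m) ^ k := by rw [hc, hBmk]; ring
    rw [hr, div_pow, div_le_iff₀ hBmk0]
    exact hnum
  -- the limit `k³ / r^k → 0`
  have hlim := tendsto_pow_const_div_const_pow_of_one_lt 3 hr1
  have hev : ∀ᶠ k : ℕ in atTop, (k : ℝ) ^ 3 / r ^ k < c⁻¹ :=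
    hlim.eventually (gt_mem_nhds (inv_pos.2 hc0))
  obtain ⟨N, hN⟩ := Filter.eventually_atTop.1 hev
  have h1 := hN (N + 1) (Nat.le_succ N)
  have h2 := hbound (N + 1) (Nat.succ_pos N)
  have hrk : 0 < r ^ (N + 1) := pow_pos (by linarith) _
  rw [div_lt_iff₀ hrk] at h1
  have h3 : c * (((N + 1 : ℕ) : ℝ)) ^ 3 < r ^ (N + 1) :=
    calc c * (((N + 1 : ℕ) : ℝ)) ^ 3 < c * (c⁻¹ * r ^ (N + 1)) := by gcongr
      _ = r ^ (N + 1) := by field_simp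
  linarith

/-- `log₂ B_q = log₂ 3 − 2/3 + (2/3) log₂ q` (`q ≥ 1`). [cite: ChristandlVranaZuiddam2021, Thm. 19 (proof)] -/
theorem logb_cwsBase {q : ℕ} (hq : 1 ≤ q) :
    Real.logb 2 (cwsBase q) = Real.logb 2 3 - 2 / 3 + 2 / 3 * Real.logb 2 q := by
  have hq0 : (0 : ℝ) < q := by exact_mod_cast hq
  unfold cwsBase
  rw [Real.logb_rpow_eq_mul_logb_of_pos (by positivity), Real.logb_div (by positivity) (by norm_num),
    Real.logb_mul (by norm_num) (by positivity), Real.logb_pow,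
    show (27 : ℝ) = 3 ^ 3 by norm_num, Real.logb_pow, show (4 : ℝ) = 2 ^ 2 by norm_num,
    Real.logb_pow, Real.logb_self_eq_one one_lt_two]
  push_cast
  ring

/-- **A witness `cw_q^{⊗m} ≥ ⟨2⟩^{⊗n}` has `n ≤ m (log₂ 3 − 2/3 + (2/3) log₂ q)`** (`q ≥ 1`).
[cite: ChristandlVranaZuiddam2021, Thm. 19 (proof)] -/
theorem le_mul_of_cwPow_restrictsTo_unitPow {q m n : ℕ} (hq : 1 ≤ q)
    (h : TensorRestrictsTo (kroneckerPow (cwTensor K q) m) (kroneckerPow (unitTensor K 2) n)) :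
    (n : ℝ) ≤ m * (Real.logb 2 3 - 2 / 3 + 2 / 3 * Real.logb 2 q) := by
  have h1 := two_pow_le_cwsBase_pow hq h
  have h2 := Real.logb_le_logb_of_le (b := 2) one_lt_two (by positivity) h1
  rw [Real.logb_pow, Real.logb_self_eq_one one_lt_two, mul_one, Real.logb_pow, logb_cwsBase hq] at h2
  exact h2

/-- `log₂ 3 − 2/3 + (2/3) log₂ q > 0` for `q ≥ 1` (`log₂ 3 ≥ 1`). [folklore] -/
theorem cwsExponent_pos {q : ℕ} (hq : 1 ≤ q) : 0 < Real.logb 2 3 - 2 / 3 + 2 / 3 * Real.logb 2 q := by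
  have h1 : 1 ≤ Real.logb 2 3 := by
    rw [← Real.logb_self_eq_one one_lt_two]
    exact Real.logb_le_logb_of_le one_lt_two (by norm_num) (by norm_num)
  have h2 : 0 ≤ Real.logb 2 q := Real.logb_nonneg one_lt_two (by exact_mod_cast hq)
  linarith

/-- **`ω(cw_q, ⟨2⟩) ≥ 1 / (log₂ 3 − 2/3 + (2/3) log₂ q)`** (`q ≥ 1`; print:
`1/ω(t,⟨2⟩) = log₂ Q̃(t) ≤ ρ^θ(t)` and `ρ^{(1/3,1/3,1/3)}(cw_q) ≤ log₂ 3 − 2/3 + (2/3) log₂ q`).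
[cite: ChristandlVranaZuiddam2021, Thm. 19 (proof)] -/
theorem inv_le_relativeExponent_cwTensor_unit {q : ℕ} (hq : 1 ≤ q) :
    1 / (Real.logb 2 3 - 2 / 3 + 2 / 3 * Real.logb 2 q) ≤
      relativeExponent (cwTensor K q) (unitTensor K 2) := by
  have hc := cwsExponent_pos hq
  refine le_relativeExponent_of_forall (fun n _ => exists_cwPow_restrictsTo_unitPow hq n)
    fun n m _ h => ?_
  have h1 := le_mul_of_cwPow_restrictsTo_unitPow hq h
  rw [one_div, inv_mul_le_iff₀ hc]
  linarith

end Subrank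

/-! ## Assembly: Theorem 19 -/

section Assembly

/-- **CVZ 2021, Theorem 19, proved**: for every field `K` and `q ≥ 1`,
`2 log₂(q+1) / (log₂ 3 − 2/3 + (2/3) log₂ q) ≤ 2 i(cw_q)`, from
`ω(⟨2⟩, cw_q) ≥ log₂(q+1)` (flattening) and `ω(cw_q, ⟨2⟩) ≥ 1/(log₂ 3 − 2/3 + (2/3) log₂ q)`
(slice-rank count in place of the printed support functional; same exponent).
[cite: ChristandlVranaZuiddam2021, Thm. 19] -/
theorem CVZ2021_thm19_holds : CVZ2021_thm19 := by
  intro K _ q hq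
  have hc := cwsExponent_pos hq
  have hA := logb_le_relativeExponent_unit_cwTensor (K := K) hq
  have hB := inv_le_relativeExponent_cwTensor_unit (K := K) hq
  have hq0 : (0 : ℝ) ≤ q := Nat.cast_nonneg q
  have hlog0 : 0 ≤ Real.logb 2 ((q : ℝ) + 1) := Real.logb_nonneg one_lt_two (by linarith)
  have hprod : Real.logb 2 ((q : ℝ) + 1) * (1 / (Real.logb 2 3 - 2 / 3 + 2 / 3 * Real.logb 2 q)) ≤
      irreversibility (cwTensor K q) := by
    unfold irreversibility
    exact mul_le_mul hA hB (by positivity) (relativeExponent_nonneg _ _)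
  calc 2 * Real.logb 2 ((q : ℝ) + 1) / (Real.logb 2 3 - 2 / 3 + 2 / 3 * Real.logb 2 q)
      = 2 * (Real.logb 2 ((q : ℝ) + 1) * (1 / (Real.logb 2 3 - 2 / 3 + 2 / 3 * Real.logb 2 q))) := by
        ring
    _ ≤ 2 * irreversibility (cwTensor K q) := by linarith

end Assembly

end Literature.Barriers.MatrixMultiplication

end
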